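/-
Copyright (c) 2026 the pub-hodgecm-mathlib formalisation cell (harness21).  Prover seat hodgecm-mathlib-K2E3-p21 (g4), Track B «K2-LIT» ∕ h413
(`stmt-HodgeConjecture-24833`), line `K2_E3_EllipticInputs`, unit U12 §L, road «GL-[M6]-sc» (line lead K2E3-p23 (g5), RULINGS #3 (M3-3) DEAL 2026-09-04T06:10:28Z),
brick B0c, file 1 of 2: «UNRAMIFIED CUBE-ROOT CHARACTERS, AND DESCENT OF SMOOTH IRREDUCIBLES TO `G_Λ = GL₃(F) ⧸ ϖ^ℤ·1`».  2026-09-04.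
-/
import Summits.HodgeConjecture.HodgeConjecture.Theorems.K2E3GL3ModCocompactCentral    -- ★ (B0a) p857674 (K2E3-p23 g5): the frame `G_Λ = GL₃(F) ⧸ Λ·1`, `normal_map_scalar`
import Literature.NumberTheory.Automorphic.IrreducibleClasses                         -- ★ `SmoothIrrep`, `IsSupercuspidal`, `IsAdmissible`, `contragredient`, `matrixCoeff`
import Literature.NumberTheory.Automorphic.ReductiveGroupData                         -- ★ `glInt`, `isOpen_glInt`, `isCompact_glInt`
import Mathlib.FieldTheory.IsAlgClosed.Basic
import Mathlib.Analysis.Complex.Polynomial.Basic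
import HarnessLib

/-!
# K2_E3 road (h413), road «GL-[M6]-sc», brick B0c (file 1): unramified cube-root characters of `F^×` and the descent `r ↦ r♭` of smooth irreducibles of
# `GL₃(F)` trivial on `ϖ·1` to `G_Λ = GL₃(F) ⧸ Λ·1`, `Λ = ϖ^ℤ` — supercuspidal ↦ supercuspidal, admissible ↦ admissible, same coefficients

Cell `pub/hodgecm-mathlib` (D-0151), Track B, seat K2E3-p21 (g4); line lead K2E3-p23 (g5) (RULINGS #3, 06:10:28Z, (M3-3): «DEAL → K2E3-p21 (g4): B0c
`Theorems/K2E3GL3SupercuspidalTwistDescent.lean` (M, rep theory over ★ `IrreducibleClasses`): for `Λ₀ := Subgroup.zpowers (Units.mk0 ϖ hϖ0)` … (a) `exists_unramified_cubeRoot`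
… (b) descent … `QuotientGroup.lift` … supercuspidal ↦ supercuspidal, admissible ↦ admissible, and the coefficient identity … (c) twist-to-descend … (d) `smoothTrace` under twist …
Split (a)(b) ∕ (c)(d) into two files if > 400 l.»), dealer K2E3-plan (g3).  `--supports stmt-HodgeConjecture-24833 --as helper`; THEOREMS ONLY (no definition ∕ instance ∕ notation ∕
named fact ∕ `sorry`); never imports `Cruxes/…/Lines`.  COUNT-NEUTRAL.  THIS FILE: (a) and (b); (c), (d) are file 2 `K2E3GL3SupercuspidalTwistDescentTwist`.

THE MATHEMATICS.
* §1 (a) For a uniformiser `ϖ` (`v(ϖ) = exp(−1)`) and any `z ∈ ℂ^×` there is an UNRAMIFIED smooth character `χ : F^× → ℂ^×` with `χ(ϖ)³ = z`: pick `z₀³ = z`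
  (`ℂ` algebraically closed) and put `χ(u) = z₀^{−log v(u)}` (`log v(ϖ) = −1`); `χ` kills `𝒪^× = {v = 1}`, which is open (`Valued.locally_const`), so `ker χ` is open.
* §2 (b, generic) DESCENT ALONG `π : G → G ⧸ N` for a normal subgroup `N ≤ ker ρ`: the descended representation is Mathlib's `QuotientGroup.lift N ρ _` on the SAME
  space, `ρ♭(π g) = ρ(g)`.  Since `π` is a continuous OPEN surjection, `π⁻¹(Stab_{ρ♭}(v)) = Stab_ρ(v)` shows smooth vectors (of `V` and of the algebraic dual)
  are the same for `ρ` and `ρ♭` (`isSmoothVector_iff_of_comp_mk`); the subrepresentation lattices coincide (`subrepresentationQuotientLiftOrderIso`), so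
  irreducibility is equivalent; matrix coefficients satisfy `c_{φ,v}^{ρ♭} ∘ π = c_{φ,v}^{ρ}`, so a support in `C·Z(G)` descends to `π(C)·Z(G⧸N)` — SUPERCUSPIDAL
  descends; and for a compact open `K' ≤ G ⧸ N`, `V^{K'} ⊆ V^{K₀ ∩ π⁻¹K'}` for any compact open `K₀ ≤ G`, so ADMISSIBLE descends.
* §3 (b, `GL₃`) `Λ = ϖ^ℤ ↦ Λ·1 ≤ ker r.ρ` iff `r.ρ(ϖ·1) = 1`; the package `exists_smoothIrrep_quotScalar`: a `SmoothIrrep G_Λ` on the same space intertwined with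
  `r` by the identity, supercuspidal if `r` is, admissible if `r` is (`K₀ = GL₃(𝒪)`).
[BushnellHenniart2006, §1.1–§2.1, §9.1 (smooth ∕ admissible ∕ twists), §11.1 (unramified characters)]; [HarishChandra1970, Part I §3 p. 9 (supercuspidal)].

HONEST LABEL: HC_CM is proved only modulo the 7 printed citations (2 remaining named inputs: hLiu418 = stmt-HodgeConjecture-24832, h413 = stmt-HodgeConjecture-24833)
until rung 0 closes; count-neutral helper.
-/

set_option autoImplicit false
set_option linter.dupNamespace false   -- `Summit.HodgeConjecture.HodgeConjecture.…` (D-0017 nested layout; lakefile exemption for Summits)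

noncomputable section

open Filter Topology TopologicalSpace Function
open scoped MatrixGroups WithZero Valued Pointwise
open Literature.NumberTheory.Automorphic

namespace Summit.HodgeConjecture.HodgeConjecture.Cruxes.H413.K2E3GL3SupercuspidalTwistDescent

/-! ## §1  (a) Unramified characters of `F^×` with prescribed cube at a uniformiser -/

section CubeRoot

variable {F : Type*} [Field F] [Valued F ℤᵐ⁰]

/-- **(a) `exists_unramified_cubeRoot`.**  For a uniformiser `ϖ` (`v(ϖ) = exp(−1)`) and every `z ∈ ℂ^×` there is a character `χ : F^× → ℂ^×` with OPEN kernel,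
trivial on `𝒪^× = {u : v(u) = 1}` (unramified), and `χ(ϖ)³ = z` (`χ = z₀^{−log ∘ v}` with `z₀³ = z`). [cite: BushnellHenniart2006, §11.1] -/
theorem exists_unramified_cubeRoot {ϖ : F} (hϖ : Valued.v ϖ = WithZero.exp (-1 : ℤ)) (hϖ0 : ϖ ≠ 0) (z : ℂˣ) :
    ∃ χ : Fˣ →* ℂˣ, IsOpen (χ.ker : Set Fˣ) ∧ (∀ u : Fˣ, Valued.v (u : F) = 1 → χ u = 1) ∧ χ (Units.mk0 ϖ hϖ0) ^ 3 = z := by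
  -- a cube root `z₀` of `z` in `ℂ^×`
  obtain ⟨z₀, hz₀⟩ := IsAlgClosed.exists_pow_nat_eq (z : ℂ) (by norm_num : 0 < 3)
  have hz₀0 : z₀ ≠ 0 := fun h => z.ne_zero (by rw [← hz₀, h]; norm_num)
  set ζ : ℂˣ := Units.mk0 z₀ hz₀0 with hζ
  have hv0 : ∀ u : Fˣ, Valued.v (u : F) ≠ 0 := fun u => (Valuation.ne_zero_iff _).2 u.ne_zero
  -- `χ(u) = ζ^{−log v(u)}`
  let χ : Fˣ →* ℂˣ :=
    { toFun := fun u => ζ ^ (-(WithZero.log (Valued.v (u : F))))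
      map_one' := by simp
      map_mul' := fun a b => by
        simp only [Units.val_mul, map_mul, WithZero.log_mul (hv0 a) (hv0 b), neg_add, zpow_add] }
  have hχ : ∀ u : Fˣ, χ u = ζ ^ (-(WithZero.log (Valued.v (u : F)))) := fun _ => rfl
  have hunit : ∀ u : Fˣ, Valued.v (u : F) = 1 → χ u = 1 := fun u hu => by
    rw [hχ, hu, WithZero.log_one, neg_zero, zpow_zero]
  refine ⟨χ, ?_, hunit, ?_⟩
  · -- the kernel contains the open neighbourhood `{u | v u = 1}` of `1`
    have hopen : IsOpen {u : Fˣ | Valued.v (u : F) = 1} := by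
      have hF : IsOpen {x : F | Valued.v x = 1} := by
        rw [isOpen_iff_mem_nhds]
        intro x hx
        have h := Valued.locally_const (show (Valued.v x : ℤᵐ⁰) ≠ 0 by rw [hx]; exact one_ne_zero)
        rw [hx] at h
        exact h
      exact hF.preimage Units.continuous_val
    refine Subgroup.isOpen_of_mem_nhds _ (g := 1) (Filter.mem_of_superset (hopen.mem_nhds (by simp)) fun u hu => ?_)
    exact (MonoidHom.mem_ker).2 (hunit u hu)
  · rw [hχ, Units.val_mk0, hϖ, WithZero.log_exp, neg_neg, zpow_one]
    exact Units.ext (by rw [Units.val_pow_eq_pow_val, hζ, Units.val_mk0, hz₀])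

end CubeRoot

/-! ## §2  (b, generic) Descent of a representation along `G → G ⧸ N`, `N ≤ ker ρ` -/

section Descent

variable {k : Type*} [Field k] {G : Type*} [Group G] [TopologicalSpace G] [IsTopologicalGroup G]
  {V : Type*} [AddCommGroup V] [Module k V] (N : Subgroup G) [N.Normal]

/-- **Smooth vectors are the same upstairs and downstairs**: if `σ'` on `G ⧸ N` and `σ` on `G` act on the same space with `σ'(π g) = σ(g)`, then
`π⁻¹ Stab_{σ'}(w) = Stab_σ(w)`, and since `π` is a continuous open surjection, `w` is smooth for `σ'` iff it is smooth for `σ`. [cite: BushnellHenniart2006, §1.1] -/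
theorem isSmoothVector_iff_of_comp_mk {W : Type*} [AddCommGroup W] [Module k W] (σ : Representation k G W) (σ' : Representation k (G ⧸ N) W)
    (h : ∀ g : G, σ' (QuotientGroup.mk g) = σ g) (w : W) : σ'.IsSmoothVector w ↔ σ.IsSmoothVector w := by
  have hpre : (QuotientGroup.mk : G → G ⧸ N) ⁻¹' (σ'.stabilizerSubgroup w : Set (G ⧸ N)) = (σ.stabilizerSubgroup w : Set G) := by
    ext g
    simp only [Set.mem_preimage, SetLike.mem_coe, Representation.mem_stabilizerSubgroup, h]
  rw [Representation.isSmoothVector_iff, Representation.isSmoothVector_iff]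
  constructor
  · intro ho
    rw [← hpre]
    exact ho.preimage QuotientGroup.continuous_mk
  · intro ho
    rw [← Set.image_preimage_eq (σ'.stabilizerSubgroup w : Set (G ⧸ N)) QuotientGroup.mk_surjective, hpre]
    exact QuotientGroup.isOpenMap_coe _ ho

variable (ρ : Representation k G V)

omit [TopologicalSpace G] [IsTopologicalGroup G] in
/-- The descended representation `ρ♭ = QuotientGroup.lift N ρ _` satisfies `ρ♭(π g) = ρ(g)`. [folklore] -/
theorem quotientLift_mk (hN : N ≤ ρ.ker) (g : G) : (QuotientGroup.lift N ρ hN : Representation k (G ⧸ N) V) (QuotientGroup.mk g) = ρ g :=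
  QuotientGroup.lift_mk N hN g

/-- **The descent of a smooth representation is smooth.** [cite: BushnellHenniart2006, §1.1] -/
theorem isSmooth_quotientLift (hN : N ≤ ρ.ker) (hρ : ρ.IsSmooth) : Representation.IsSmooth (QuotientGroup.lift N ρ hN : Representation k (G ⧸ N) V) :=
  fun v => (isSmoothVector_iff_of_comp_mk N ρ _ (quotientLift_mk N ρ hN) v).2 (hρ v)

omit [TopologicalSpace G] [IsTopologicalGroup G] in
/-- **Same subrepresentation lattice**: the subrepresentations of `ρ♭` on `G ⧸ N` and of `ρ` on `G` are the same submodules. [cite: BushnellHenniart2006, §1.1] -/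
theorem exists_subrepresentation_orderIso (hN : N ≤ ρ.ker) :
    ∃ e : Subrepresentation (QuotientGroup.lift N ρ hN : Representation k (G ⧸ N) V) ≃o Subrepresentation ρ, ∀ W, (e W).toSubmodule = W.toSubmodule := by
  refine ⟨{ toFun := fun W => ⟨W.toSubmodule, fun g v hv => by
              have h := W.apply_mem_toSubmodule (QuotientGroup.mk g) hv
              rwa [quotientLift_mk] at h⟩
            invFun := fun W => ⟨W.toSubmodule, fun x v hv => by
              induction x using QuotientGroup.induction_on with
              | H g => rw [quotientLift_mk]; exact W.apply_mem_toSubmodule g hv⟩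
            left_inv := fun W => by ext; rfl
            right_inv := fun W => by ext; rfl
            map_rel_iff' := Iff.rfl }, fun W => rfl⟩

omit [TopologicalSpace G] [IsTopologicalGroup G] in
/-- **The descent is irreducible iff the original is.** [cite: BushnellHenniart2006, §1.1] -/
theorem isIrreducible_quotientLift_iff (hN : N ≤ ρ.ker) :
    Representation.IsIrreducible (QuotientGroup.lift N ρ hN : Representation k (G ⧸ N) V) ↔ ρ.IsIrreducible := by
  obtain ⟨e, -⟩ := exists_subrepresentation_orderIso N ρ hN
  exact e.isSimpleOrder_iff

omit [TopologicalSpace G] [IsTopologicalGroup G] in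
/-- The algebraic duals agree: `(ρ♭)^∨(π g) = ρ^∨(g)`. [folklore] -/
theorem dual_quotientLift_mk (hN : N ≤ ρ.ker) (g : G) :
    Representation.dual (QuotientGroup.lift N ρ hN : Representation k (G ⧸ N) V) (QuotientGroup.mk g) = ρ.dual g := by
  rw [Representation.dual_apply, Representation.dual_apply, ← QuotientGroup.mk_inv, quotientLift_mk]

/-- **Same contragredient**: a linear form is a smooth vector of `(ρ♭)^∨` iff it is one of `ρ^∨`. [cite: BushnellHenniart2006, §2.8] -/
theorem mem_contragredient_quotientLift_iff (hN : N ≤ ρ.ker) (φ : Module.Dual k V) :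
    φ ∈ Representation.contragredient (QuotientGroup.lift N ρ hN : Representation k (G ⧸ N) V) ↔ φ ∈ ρ.contragredient := by
  rw [Representation.mem_contragredient, Representation.mem_contragredient]
  exact isSmoothVector_iff_of_comp_mk N ρ.dual _ (dual_quotientLift_mk N ρ hN) φ

omit [TopologicalSpace G] [IsTopologicalGroup G] in
/-- **The coefficient identity**: `c^{ρ♭}_{φ,v}(π g) = c^{ρ}_{φ,v}(g)`. [cite: HarishChandra1970, Part I §3 p. 9] -/
theorem matrixCoeff_quotientLift_mk (hN : N ≤ ρ.ker) (φ : Module.Dual k V) (v : V) (g : G) :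
    Representation.matrixCoeff (QuotientGroup.lift N ρ hN : Representation k (G ⧸ N) V) φ v (QuotientGroup.mk g) = ρ.matrixCoeff φ v g := by
  rw [Representation.matrixCoeff_apply, Representation.matrixCoeff_apply, quotientLift_mk]

omit [TopologicalSpace G] [IsTopologicalGroup G] in
/-- The image of the centre of `G` in `G ⧸ N` is central. [folklore] -/
theorem mk_mem_center {z : G} (hz : z ∈ Subgroup.center G) : (QuotientGroup.mk z : G ⧸ N) ∈ Subgroup.center (G ⧸ N) := by
  rw [Subgroup.mem_center_iff]
  intro x
  induction x using QuotientGroup.induction_on with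
  | H g => rw [← QuotientGroup.mk_mul, ← QuotientGroup.mk_mul, Subgroup.mem_center_iff.1 hz g]

/-- **SUPERCUSPIDAL DESCENDS**: if every coefficient of `ρ` is supported in `C·Z(G)` (`C` compact), then every coefficient of `ρ♭` is supported in `π(C)·Z(G ⧸ N)`.
[cite: HarishChandra1970, Part I §3 p. 9] -/
theorem isSupercuspidal_quotientLift (hN : N ≤ ρ.ker) (h : ρ.IsSupercuspidal) : Representation.IsSupercuspidal (QuotientGroup.lift N ρ hN : Representation k (G ⧸ N) V) := by
  intro φ hφ v
  obtain ⟨C, hC, hsupp⟩ := h φ ((mem_contragredient_quotientLift_iff N ρ hN φ).1 hφ) v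
  refine ⟨QuotientGroup.mk '' C, hC.image QuotientGroup.continuous_mk, fun x hx => ?_⟩
  induction x using QuotientGroup.induction_on with
  | H g =>
    have hg : g ∈ Function.support (ρ.matrixCoeff φ v) := by
      rw [Function.mem_support] at hx ⊢
      rwa [matrixCoeff_quotientLift_mk] at hx
    obtain ⟨c, hc, y, hy, hcy⟩ := Set.mem_mul.1 (hsupp hg)
    refine Set.mem_mul.2 ⟨QuotientGroup.mk c, Set.mem_image_of_mem _ hc, QuotientGroup.mk y, mk_mem_center N hy, ?_⟩
    rw [← QuotientGroup.mk_mul, hcy]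

/-- **ADMISSIBLE DESCENDS** (given one compact open subgroup `K₀ ≤ G`): for `K' ≤ G ⧸ N` compact open, `V^{K'} ⊆ V^{K₀ ∩ π⁻¹K'}` is finite dimensional.
[cite: BushnellHenniart2006, §2.1] -/
theorem isAdmissible_quotientLift (hN : N ≤ ρ.ker) (K₀ : OpenSubgroup G) (hK₀ : IsCompact (K₀ : Set G)) (h : ρ.IsAdmissible) :
    Representation.IsAdmissible (QuotientGroup.lift N ρ hN : Representation k (G ⧸ N) V) := by
  refine ⟨isSmooth_quotientLift N ρ hN h.1, fun K' hK' => ?_⟩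
  -- the compact open subgroup `K'' = K₀ ∩ π⁻¹ K'` of `G`
  let K'' : OpenSubgroup G :=
    ⟨(K₀ : Subgroup G) ⊓ (K' : Subgroup (G ⧸ N)).comap (QuotientGroup.mk' N), K₀.isOpen.inter (K'.isOpen.preimage QuotientGroup.continuous_mk)⟩
  have hK''sub : (K'' : Set G) ⊆ (K₀ : Set G) := fun g hg => hg.1
  have hK''c : IsCompact (K'' : Set G) := hK₀.of_isClosed_subset K''.isClosed hK''sub
  haveI : Module.Finite k (ρ.fixedPoints (K'' : Subgroup G)) := h.2 K'' hK''c
  have hle : Representation.fixedPoints (QuotientGroup.lift N ρ hN : Representation k (G ⧸ N) V) (K' : Subgroup (G ⧸ N)) ≤ ρ.fixedPoints (K'' : Subgroup G) := by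
    intro v hv
    rw [Representation.mem_fixedPoints] at hv ⊢
    intro g hg
    have h' := hv (QuotientGroup.mk g) hg.2
    rwa [quotientLift_mk] at h'
  exact Submodule.finiteDimensional_of_le hle

end Descent

/-! ## §3  (b, `GL₃`) Descent to `G_Λ = GL₃(F) ⧸ Λ·1`, `Λ = ϖ^ℤ` -/

section GL3

variable {F : Type*} [Field F] [Valued F ℤᵐ⁰] [ValuativeRel F] [(Valued.v : Valuation F ℤᵐ⁰).Compatible] [IsNonarchimedeanLocalField F]

omit [ValuativeRel F] [(Valued.v : Valuation F ℤᵐ⁰).Compatible] [IsNonarchimedeanLocalField F] in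
/-- `Λ·1 ≤ ker r.ρ` for `Λ = ϖ^ℤ` as soon as `r.ρ(ϖ·1) = 1`. [folklore] -/
theorem map_scalar_zpowers_le_ker {ϖ : F} (hϖ0 : ϖ ≠ 0) (r : SmoothIrrep (GL (Fin 3) F))
    (hr : r.ρ (Matrix.GeneralLinearGroup.scalar (Fin 3) (Units.mk0 ϖ hϖ0)) = 1) :
    (Subgroup.zpowers (Units.mk0 ϖ hϖ0)).map (Matrix.GeneralLinearGroup.scalar (Fin 3)) ≤ r.ρ.ker := by
  rw [Subgroup.map_le_iff_le_comap, Subgroup.zpowers_le, Subgroup.mem_comap, MonoidHom.mem_ker]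
  exact hr

omit [(Valued.v : Valuation F ℤᵐ⁰).Compatible] in
/-- **(b) THE DESCENT PACKAGE `r ↦ r♭`.**  For `r` an irreducible smooth representation of `GL₃(F)` with `r.ρ(ϖ·1) = 1` there is an irreducible smooth representation
`r♭` of `G_Λ = GL₃(F) ⧸ Λ·1` (`Λ = ϖ^ℤ`) on the same space (`e = id`), with `r♭(π g) = r(g)` — so `B v (r♭(π g) v) = B v (r(g) v)` for every form `B` —,
supercuspidal if `r` is, admissible if `r` is (`r♭.ρ = QuotientGroup.lift _ r.ρ _`, §2 with `K₀ = GL₃(𝒪)`).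
[cite: BushnellHenniart2006, §1.1–§2.1] [cite: HarishChandra1970, Part I §3 p. 9] -/
theorem exists_smoothIrrep_quotScalar {ϖ : F} (hϖ0 : ϖ ≠ 0)
    [((Subgroup.zpowers (Units.mk0 ϖ hϖ0)).map (Matrix.GeneralLinearGroup.scalar (Fin 3))).Normal]
    (r : SmoothIrrep (GL (Fin 3) F)) (hr : r.ρ (Matrix.GeneralLinearGroup.scalar (Fin 3) (Units.mk0 ϖ hϖ0)) = 1) :
    ∃ r' : SmoothIrrep (GL (Fin 3) F ⧸ (Subgroup.zpowers (Units.mk0 ϖ hϖ0)).map (Matrix.GeneralLinearGroup.scalar (Fin 3))),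
      ∃ e : r'.V ≃ₗ[ℂ] r.V, (∀ (g : GL (Fin 3) F) (v : r'.V), e (r'.ρ (QuotientGroup.mk g) v) = r.ρ g (e v)) ∧
        (r.ρ.IsSupercuspidal → r'.ρ.IsSupercuspidal) ∧ (r.ρ.IsAdmissible → r'.ρ.IsAdmissible) := by
  haveI : IsTopologicalRing F := inferInstance
  have hN := map_scalar_zpowers_le_ker hϖ0 r hr
  let K₀ : OpenSubgroup (GL (Fin 3) F) := ⟨glInt 3 F, isOpen_glInt 3 F⟩
  refine ⟨⟨r.V, QuotientGroup.lift _ r.ρ hN, (isIrreducible_quotientLift_iff _ r.ρ hN).2 r.isIrreducible, isSmooth_quotientLift _ r.ρ hN r.isSmooth⟩,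
    LinearEquiv.refl ℂ r.V, fun g v => ?_, isSupercuspidal_quotientLift _ r.ρ hN, isAdmissible_quotientLift _ r.ρ hN K₀ (isCompact_glInt 3 F)⟩
  show (QuotientGroup.lift _ r.ρ hN : Representation ℂ _ r.V) (QuotientGroup.mk g) v = r.ρ g v
  rw [quotientLift_mk]

end GL3

end Summit.HodgeConjecture.HodgeConjecture.Cruxes.H413.K2E3GL3SupercuspidalTwistDescent

end
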